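import Literature.MathematicalPhysics.QuantumFieldTheory.Balaban1983to89.T4HaarSU2LocalDiffeo

/-!
# Route `ReplicaVarianceTilt` — crux `HeightChiSqL` (stmt-QuantumFields-26133), toward the residual of `stub_acIntegrable`:
# QUANTITATIVE LEMMA A ON `SU(2)` — a map with a TANGENT FLOOR and a FINITE INJECTIVITY COVER pushes restricted Haar measure to a
# DOMINATED measure (the `≤ C • Haar` sibling of the tree's `T4HaarSU2LocalDiffeo`; helper `--supports stmt-QuantumFields-26133`)

Width seat `ym-line-sfw-p2-w3` gen 21 (home cell `ym-idea-1`; R3 RECORD rung — no summit, no rung and no crux is proved here; the YM mass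
gap is NOT proved by any of this).  Pure calculus / measure theory over Mathlib and the tree's quaternion model of `SU(2)`; every
declaration is [folklore].  PURPOSE: the series `…HeightChiSqLAbsCont` … `…HeightChiSqLOfFibreLawBound` reduced the registered stub
`stub_acIntegrable` of crux `HeightChiSqL` to ONE geometric statement — the guarded exp-mean-log fibre laws of Bałaban's block averaging
(0.4) on `SU(2)` are DOMINATED by Haar measure (`HeightChiSqLOfFibreLawBound.stubText_of_fibreLawBound`).  The tree's engine for such
fibre laws, `T4HaarSU2LocalDiffeo.haar_restrict_map_absolutelyContinuous` (Lemma A: injective tangent differential on an open set ⇒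
`(Haar|_S).map K ≪ Haar`), yields absolute continuity only.  This file is its QUANTITATIVE form, the map-independent half of the
remaining work:

* §1 (real inner product spaces) `apply_self_eq_of_coneExt` — Euler's identity `D x = F x` for a map agreeing near `x ≠ 0` with the
  1-homogeneous cone extension `y ↦ ‖y‖ • k (y/‖y‖)`; `exists_hasStrictFDerivAt_coneExt_lower` — a TANGENT FLOOR `c‖v‖ ≤ ‖k′ v‖` on `x^⊥`
  (`0 < c ≤ 1`, `k` unit-valued near `x/‖x‖`) gives a FULL FLOOR `c‖h‖ ≤ ‖D h‖` for the strict derivative `D` of `F` at `x` (Euler + the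
  tree's tangency identity `⟪F x, D h⟫ = ⟪x, h⟫` + Pythagoras).
* §2 (finite-dimensional real normed spaces with an additive Haar measure) `pow_finrank_le_abs_det` — `c‖h‖ ≤ ‖T h‖` for all `h` forces
  `c^{dim} ≤ |det T|` (the image of the unit ball contains the ball of radius `c`; `Measure.addHaar_image_continuousLinearMap`).
* §3 `measure_image_ge_of_coneExt` — QUANTITATIVE LEMMA A IN THE CONE: with the data of the tree's `measure_inter_preimage_null_of_coneExt`
  plus the tangent floor, `c^{dim}·μ(A) ≤ μ(F(A))` for every measurable `A` in the cone on which `F` is injective (Mathlib's change of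
  variables `lintegral_abs_det_fderiv_eq_addHaar_image`).
* §4 `haar_restrict_map_le_smul` (`SU(2)`, quaternion form; also `haarData_…` for the cell's `HaarData.haar`): `S ⊆ SU(2)` open, `K` measurable,
  `k : ℍ → ℍ` representing `K` on the unit sphere over `S` with strict derivatives `k′ u` and tangent floor `c`, and a cover of `S` by `n`
  measurable pieces on each of which `K` is injective ⟹ `((Haar).restrict S).map K ≤ (n · (ofReal c⁴)⁻¹) • Haar` (cone picture
  `Haar = vol(B₁)⁻¹·(vol|_{B₁}).map quatToSU2` of `QuantumLattice.SU2Haar`, §3 on each cone piece, norm preservation of the cone extension).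
WHAT IS LEFT for the stub (NOT here): for the guarded exp-mean-log fibre map `W ↦ exp(Σ_k |I|⁻¹ log(h_k W*))·W` on `{‖h_k W* − 1‖ < 1/3} ⊆ SU(2)`
(tree `BlockAveragingEMLHaarAC` §2), (a) a tangent floor `c > 0` UNIFORM in the frozen holonomies `h_k` (quantitative
`T4EMLTangentInjective.emlD_tangent_injective`, by coercivity or by compactness), and (b) a finite injectivity cover of the guard uniform in
`h_k`; then §4 + `HeightChiSqLOfFibreLawBound.stubText_of_fibreLawBound` close `stub_acIntegrable`.  No estimate of Bałaban's is used.
-/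

noncomputable section

open MeasureTheory Set Metric Function Filter
open scoped RealInnerProductSpace Topology ENNReal Pointwise Quaternion

namespace Summit.QuantumFields.YangMills.Theorems.HeightChiSqLHaarDominated

open Literature.MathematicalPhysics.QuantumFieldTheory.Balaban1983to89.T4HaarSU2LocalDiffeo
  (hasStrictFDerivAt_coneExt inner_apply_eq_of_norm_eq isOpen_cone)

/-! ## 1. Cone extensions: a tangent floor gives a floor for the full derivative -/

section Cone

variable {E : Type*} [NormedAddCommGroup E] [InnerProductSpace ℝ E]

/-- EULER'S IDENTITY FOR A CONE EXTENSION: if `F` agrees near `x ≠ 0` with the 1-homogeneous map `y ↦ ‖y‖ • k (y/‖y‖)` and has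
derivative `D` at `x`, then `D x = F x`. [folklore] -/
theorem apply_self_eq_of_coneExt {F k : E → E} {D : E →L[ℝ] E} {x : E} (hx : x ≠ 0)
    (hF : (fun y : E => ‖y‖ • k (‖y‖⁻¹ • y)) =ᶠ[𝓝 x] F) (hD : HasFDerivAt F D x) : D x = F x := by
  -- the curve `t ↦ F (t • x)` through `t = 1`
  have hcurve : HasDerivAt (fun t : ℝ => F (t • x)) (D x) 1 := by
    have h1 : HasDerivAt (fun t : ℝ => t • x) x 1 := by
      simpa using (hasDerivAt_id (1 : ℝ)).smul_const x
    have h2 : HasFDerivAt F D ((1 : ℝ) • x) := by rwa [one_smul]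
    exact h2.comp_hasDerivAt (1 : ℝ) h1
  -- near `t = 1` the curve is `t ↦ t • F x`
  have hcont : Tendsto (fun t : ℝ => t • x) (𝓝 1) (𝓝 x) := by
    have : Continuous fun t : ℝ => t • x := continuous_id.smul continuous_const
    simpa using this.tendsto 1
  have hFx : F x = ‖x‖ • k (‖x‖⁻¹ • x) := (hF.self_of_nhds).symm
  have hev : (fun t : ℝ => F (t • x)) =ᶠ[𝓝 1] fun t => t • F x := by
    have hpos : ∀ᶠ t : ℝ in 𝓝 1, 0 < t := eventually_gt_nhds one_pos
    filter_upwards [hcont.eventually hF.symm, hpos] with t ht htpos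
    -- ht : F (t • x) = ‖t • x‖ • k (‖t • x‖⁻¹ • (t • x))
    rw [ht, hFx, norm_smul, Real.norm_of_nonneg htpos.le, smul_smul (t * ‖x‖)⁻¹ t x, mul_inv,
      show t⁻¹ * ‖x‖⁻¹ * t = ‖x‖⁻¹ by field_simp, smul_smul, mul_comm t]
  have hline : HasDerivAt (fun t : ℝ => t • F x) (F x) 1 := by
    simpa using (hasDerivAt_id (1 : ℝ)).smul_const (F x)
  exact (hcurve.congr_of_eventuallyEq hev.symm).unique hline

/-- **A TANGENT FLOOR GIVES A FLOOR FOR THE DERIVATIVE OF A CONE EXTENSION**: if `F` agrees near `x ≠ 0` with `y ↦ ‖y‖ • k (y/‖y‖)`, has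
`‖F y‖ = ‖y‖` near `x`, `k` has strict derivative `k′` at `x/‖x‖` with `c‖v‖ ≤ ‖k′ v‖` on `x^⊥` (`0 < c ≤ 1`), then `F` has a strict
derivative `D` at `x` with `c‖h‖ ≤ ‖D h‖` for ALL `h` (Euler `D x = F x`, tangency `k′ v ⊥ F x`, Pythagoras). [folklore] -/
theorem exists_hasStrictFDerivAt_coneExt_lower {F k : E → E} {k' : E →L[ℝ] E} {x : E} (hx : x ≠ 0)
    (hk : HasStrictFDerivAt k k' (‖x‖⁻¹ • x)) (hF : (fun y : E => ‖y‖ • k (‖y‖⁻¹ • y)) =ᶠ[𝓝 x] F)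
    (heq : ∀ᶠ y in 𝓝 x, ‖F y‖ = ‖y‖) {c : ℝ} (hc0 : 0 < c) (hc1 : c ≤ 1)
    (hbd : ∀ v, ⟪x, v⟫ = 0 → c * ‖v‖ ≤ ‖k' v‖) :
    ∃ D : E →L[ℝ] E, HasStrictFDerivAt F D x ∧ ∀ h, c * ‖h‖ ≤ ‖D h‖ := by
  obtain ⟨D, hD, hDv⟩ := hasStrictFDerivAt_coneExt hx hk
  have hDF : HasStrictFDerivAt F D x := hD.congr_of_eventuallyEq hF
  have hEuler : D x = F x := apply_self_eq_of_coneExt hx hF hDF.hasFDerivAt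
  have hnormF : ‖F x‖ = ‖x‖ := heq.self_of_nhds
  have htan : ∀ h, ⟪F x, D h⟫ = ⟪x, h⟫ := inner_apply_eq_of_norm_eq hDF.hasFDerivAt heq
  refine ⟨D, hDF, fun h => ?_⟩
  -- decompose `h = a • x + v`, `v ⊥ x`
  have hx2 : (0 : ℝ) < ‖x‖ ^ 2 := by positivity
  set a : ℝ := ⟪x, h⟫ / ‖x‖ ^ 2 with ha
  set v : E := h - a • x with hv
  have hxv : ⟪x, v⟫ = 0 := by
    rw [hv, inner_sub_right, real_inner_smul_right, real_inner_self_eq_norm_sq, ha]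
    field_simp
    ring
  have hh : h = a • x + v := by rw [hv]; abel
  -- `D h = a • F x + k' v` with the two summands orthogonal
  have hDh : D h = a • F x + k' v := by
    rw [hh, map_add, map_smul, hEuler, hDv v hxv]
  have horth : ⟪a • F x, k' v⟫ = 0 := by
    rw [real_inner_smul_left, ← hDv v hxv, htan v, hxv, mul_zero]
  have horth' : ⟪a • x, v⟫ = 0 := by rw [real_inner_smul_left, hxv, mul_zero]
  have hnD : ‖D h‖ ^ 2 = a ^ 2 * ‖x‖ ^ 2 + ‖k' v‖ ^ 2 := by
    rw [hDh, norm_add_sq_real, horth, mul_zero, add_zero, norm_smul, Real.norm_eq_abs, mul_pow, sq_abs, hnormF]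
  have hnh : ‖h‖ ^ 2 = a ^ 2 * ‖x‖ ^ 2 + ‖v‖ ^ 2 := by
    conv_lhs => rw [hh]
    rw [norm_add_sq_real, horth', mul_zero, add_zero, norm_smul, Real.norm_eq_abs, mul_pow, sq_abs]
  have hkv : c ^ 2 * ‖v‖ ^ 2 ≤ ‖k' v‖ ^ 2 := by
    rw [← mul_pow]
    exact pow_le_pow_left₀ (by positivity) (hbd v hxv) 2
  have hc2 : c ^ 2 ≤ 1 := by nlinarith
  have h3 : c ^ 2 * (a ^ 2 * ‖x‖ ^ 2) ≤ a ^ 2 * ‖x‖ ^ 2 := mul_le_of_le_one_left (by positivity) hc2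
  have hsq : (c * ‖h‖) ^ 2 ≤ ‖D h‖ ^ 2 := by
    rw [mul_pow, hnh, hnD]
    linarith
  exact (pow_le_pow_iff_left₀ (by positivity) (norm_nonneg _) two_ne_zero).mp hsq

end Cone

/-! ## 2. A floor `c‖h‖ ≤ ‖T h‖` forces `|det T| ≥ c^{dim}` -/

section Det

variable {E : Type*} [NormedAddCommGroup E] [NormedSpace ℝ E] [FiniteDimensional ℝ E] [MeasurableSpace E] [BorelSpace E]
  (μ : Measure E) [μ.IsAddHaarMeasure]

include μ in
/-- **A NORM FLOOR BOUNDS THE DETERMINANT FROM BELOW**: `c‖h‖ ≤ ‖T h‖` for all `h` (`c > 0`) gives `c^{dim E} ≤ |det T|` (the image of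
the unit ball contains the ball of radius `c`; volumes scale by `|det T|`). [folklore] -/
theorem pow_finrank_le_abs_det (T : E →L[ℝ] E) {c : ℝ} (hc : 0 < c) (hT : ∀ h, c * ‖h‖ ≤ ‖T h‖) :
    c ^ Module.finrank ℝ E ≤ |T.det| := by
  have hinj : Function.Injective T := by
    refine (injective_iff_map_eq_zero T).2 fun h hh => ?_
    have := hT h
    rw [hh, norm_zero] at this
    exact norm_eq_zero.mp (le_antisymm (by nlinarith [norm_nonneg h]) (norm_nonneg h))
  have hsurj : Function.Surjective T := LinearMap.surjective_of_injective (f := (T : E →ₗ[ℝ] E)) hinj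
  have hball : ball (0 : E) c ⊆ T '' ball (0 : E) 1 := by
    intro y hy
    obtain ⟨h, rfl⟩ := hsurj y
    refine ⟨h, ?_, rfl⟩
    rw [mem_ball_zero_iff] at hy ⊢
    have := hT h
    nlinarith
  have hvol := measure_mono (μ := μ) hball
  rw [Measure.addHaar_image_continuousLinearMap, Measure.addHaar_ball_of_pos μ 0 hc] at hvol
  have hb0 : μ (ball (0 : E) 1) ≠ 0 := (measure_ball_pos μ 0 one_pos).ne'
  have hbt : μ (ball (0 : E) 1) ≠ ⊤ := measure_ball_lt_top.ne
  have := (ENNReal.mul_le_mul_iff_left hb0 hbt).mp hvol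
  exact (ENNReal.ofReal_le_ofReal_iff (abs_nonneg _)).mp this

end Det

/-! ## 3. Quantitative Lemma A in the cone picture -/

section ConeLemmaA

variable {E : Type*} [NormedAddCommGroup E] [InnerProductSpace ℝ E] [FiniteDimensional ℝ E] [MeasurableSpace E]
  [BorelSpace E] (μ : Measure E) [μ.IsAddHaarMeasure]

/-- **QUANTITATIVE LEMMA A IN THE CONE.** `C` open with `0 ∉ C`; `F` equal on `C` to the cone extension `y ↦ ‖y‖ • k (y/‖y‖)` of a map
`k` which, at each retracted point `x/‖x‖` (`x ∈ C`), has a strict derivative `k′ x` of unit value and with TANGENT FLOOR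
`c‖v‖ ≤ ‖k′ x v‖` on `x^⊥` (`0 < c ≤ 1`).  Then for every measurable `A ⊆ C` on which `F` is injective,
`c^{dim E} · μ(A) ≤ μ(F(A))` — so `μ(A) ≤ c^{−dim E} μ(N)` whenever `F(A) ⊆ N`. [folklore] -/
theorem measure_image_ge_of_coneExt {C : Set E} (hC : IsOpen C) (hC0 : (0 : E) ∉ C) {F : E → E}
    {k : E → E} {k' : E → E →L[ℝ] E} (hFk : ∀ x ∈ C, F x = ‖x‖ • k (‖x‖⁻¹ • x))
    (hk : ∀ x ∈ C, HasStrictFDerivAt k (k' x) (‖x‖⁻¹ • x)) (hsph : ∀ x ∈ C, ‖k (‖x‖⁻¹ • x)‖ = 1)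
    {c : ℝ} (hc0 : 0 < c) (hc1 : c ≤ 1) (hbd : ∀ x ∈ C, ∀ v, ⟪x, v⟫ = 0 → c * ‖v‖ ≤ ‖k' x v‖)
    {A : Set E} (hA : MeasurableSet A) (hAC : A ⊆ C) (hinj : InjOn F A) :
    ENNReal.ofReal (c ^ Module.finrank ℝ E) * μ A ≤ μ (F '' A) := by
  have key : ∀ x ∈ C, ∃ D : E →L[ℝ] E, HasStrictFDerivAt F D x ∧ ∀ h, c * ‖h‖ ≤ ‖D h‖ := by
    intro x hx
    have hx0 : x ≠ 0 := fun h => hC0 (h ▸ hx)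
    have hCx : C ∈ 𝓝 x := hC.mem_nhds hx
    refine exists_hasStrictFDerivAt_coneExt_lower hx0 (hk x hx) ?_ ?_ hc0 hc1 (hbd x hx)
    · exact Filter.eventually_of_mem hCx fun y hy => (hFk y hy).symm
    · exact Filter.eventually_of_mem hCx fun y hy => by rw [hFk y hy, norm_smul, norm_norm, hsph y hy, mul_one]
  choose! D hD hlow using key
  have hdet : ∀ x ∈ A, ENNReal.ofReal (c ^ Module.finrank ℝ E) ≤ ENNReal.ofReal |(D x).det| := fun x hx =>
    ENNReal.ofReal_le_ofReal (pow_finrank_le_abs_det μ (D x) hc0 (hlow x (hAC hx)))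
  calc ENNReal.ofReal (c ^ Module.finrank ℝ E) * μ A
      = ∫⁻ _ in A, ENNReal.ofReal (c ^ Module.finrank ℝ E) ∂μ := (setLIntegral_const _ _).symm
    _ ≤ ∫⁻ x in A, ENNReal.ofReal |(D x).det| ∂μ := setLIntegral_mono' hA hdet
    _ = μ (F '' A) := lintegral_abs_det_fderiv_eq_addHaar_image μ hA
        (fun x hx => (hD x (hAC hx)).hasFDerivAt.hasFDerivWithinAt) hinj

end ConeLemmaA

/-! ## 4. `SU(2)`: a dominated push-forward from a tangent floor and a finite injectivity cover -/

section SUTwo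

open Literature.MathematicalPhysics.QuantumLattice (su2Quat norm_su2Quat quatToSU2 quatToSU2_su2Quat measurable_quatToSU2
  quatToSU2_smul su2BallMeasure haarProbability_su2_eq_su2BallMeasure)
open Literature.MathematicalPhysics.QuantumFieldTheory.Balaban1983to89.T4HaarSU2Translate (su2Quat_quatToSU2 measurable_su2Quat)
open Literature.MathematicalPhysics.QuantumFieldTheory (haarProbability)

/-- **QUANTITATIVE LEMMA A ON `SU(2)` (quaternion form).**  Let `S ⊆ SU(2)` be open and `K : SU(2) → SU(2)` measurable.  Suppose a map
`k : ℍ → ℍ` satisfies, at every unit quaternion `u` over `S`: (i) `k` has a strict derivative `k′ u` at `u`; (ii) `k u = su2Quat (K (quatToSU2 u))`;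
(iii′) the TANGENT FLOOR `c‖v‖ ≤ ‖k′ u v‖` for `v ⊥ u` (`0 < c ≤ 1`); and (iv) `S` is covered by finitely many measurable pieces on each of which
`K` is injective.  Then the push-forward of Haar measure restricted to `S` is DOMINATED: `((Haar).restrict S).map K ≤ (n · c⁻⁴) • Haar`.
(The cone picture `Haar = vol(B₁)⁻¹·(vol|B₁).map quatToSU2`, §3 on each cone piece, and the norm-preserving cone extension.) [folklore] -/
theorem haar_restrict_map_le_smul {S : Set (Matrix.specialUnitaryGroup (Fin 2) ℂ)} (hS : IsOpen S) {K : (Matrix.specialUnitaryGroup (Fin 2) ℂ) → (Matrix.specialUnitaryGroup (Fin 2) ℂ)} (hK : Measurable K)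
    {k : ℍ → ℍ} {k' : ℍ → ℍ →L[ℝ] ℍ}
    (hk : ∀ u : ℍ, ‖u‖ = 1 → quatToSU2 u ∈ S → HasStrictFDerivAt k (k' u) u)
    (hkK : ∀ u : ℍ, ‖u‖ = 1 → quatToSU2 u ∈ S → k u = su2Quat (K (quatToSU2 u)))
    {c : ℝ} (hc0 : 0 < c) (hc1 : c ≤ 1)
    (hbd : ∀ u : ℍ, ‖u‖ = 1 → quatToSU2 u ∈ S → ∀ v : ℍ, ⟪u, v⟫ = 0 → c * ‖v‖ ≤ ‖k' u v‖)
    {n : ℕ} (piece : Fin n → Set (Matrix.specialUnitaryGroup (Fin 2) ℂ)) (hpm : ∀ i, MeasurableSet (piece i)) (hcover : S ⊆ ⋃ i, piece i)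
    (hinj : ∀ i, InjOn K (piece i)) :
    ((haarProbability (Matrix.specialUnitaryGroup (Fin 2) ℂ)).restrict S).map K ≤ ((n : ℝ≥0∞) * (ENNReal.ofReal (c ^ 4))⁻¹) • haarProbability (Matrix.specialUnitaryGroup (Fin 2) ℂ) := by
  letI : MeasurableSpace ℍ := Literature.Analysis.FluidPDE.Tao2016.quatMeasurableSpace
  haveI : BorelSpace ℍ := Literature.Analysis.FluidPDE.Tao2016.quatBorelSpace
  haveI := Literature.MathematicalPhysics.QuantumLattice.secondCountableTopology_su2
  refine Measure.le_iff.2 fun N hN => ?_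
  rw [Measure.map_apply hK hN, Measure.restrict_apply (hK hN), Measure.smul_apply, smul_eq_mul]
  -- the cone and the cone extension
  set C : Set ℍ := {(0 : ℍ)}ᶜ ∩ quatToSU2 ⁻¹' S with hC_def
  have hC : IsOpen C := isOpen_cone hS
  have hC0 : (0 : ℍ) ∉ C := fun h => h.1 rfl
  set F : ℍ → ℍ := fun x => ‖x‖ • su2Quat (K (quatToSU2 x)) with hF_def
  have hunit : ∀ x : ℍ, x ≠ 0 → ‖‖x‖⁻¹ • x‖ = 1 := fun x hx => by
    rw [norm_smul, norm_inv, norm_norm, inv_mul_cancel₀ (norm_ne_zero_iff.2 hx)]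
  have hproj : ∀ x : ℍ, x ≠ 0 → quatToSU2 (‖x‖⁻¹ • x) = quatToSU2 x := fun x hx =>
    quatToSU2_smul (inv_pos.2 (norm_pos_iff.2 hx)) x
  have hnormF : ∀ x : ℍ, ‖F x‖ = ‖x‖ := fun x => by
    simp only [hF_def, norm_smul, norm_norm, norm_su2Quat, mul_one]
  have hFx : ∀ x : ℍ, x ≠ 0 → quatToSU2 (F x) = K (quatToSU2 x) := fun x hx => by
    simp only [hF_def]
    rw [quatToSU2_smul (norm_pos_iff.2 hx), quatToSU2_su2Quat]
  -- the Haar measure in the cone picture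
  have hHaar : ∀ T : Set (Matrix.specialUnitaryGroup (Fin 2) ℂ), MeasurableSet T →
      haarProbability (Matrix.specialUnitaryGroup (Fin 2) ℂ) T = (volume (ball (0 : ℍ) 1))⁻¹ * volume (quatToSU2 ⁻¹' T ∩ ball (0 : ℍ) 1) := by
    intro T hT
    rw [haarProbability_su2_eq_su2BallMeasure]
    simp only [su2BallMeasure, Measure.smul_apply, smul_eq_mul]
    rw [Measure.map_apply measurable_quatToSU2 hT, Measure.restrict_apply (measurable_quatToSU2 hT)]
  -- the cone pieces
  set A : Fin n → Set ℍ := fun i => ((C ∩ quatToSU2 ⁻¹' (piece i)) ∩ ball (0 : ℍ) 1) ∩ quatToSU2 ⁻¹' (K ⁻¹' N)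
    with hA_def
  have hAm : ∀ i, MeasurableSet (A i) := fun i =>
    ((hC.measurableSet.inter (measurable_quatToSU2 (hpm i))).inter measurableSet_ball).inter
      (measurable_quatToSU2 (hK hN))
  have hAC : ∀ i, A i ⊆ C := fun i x hx => hx.1.1.1
  have hsub : quatToSU2 ⁻¹' (K ⁻¹' N ∩ S) ∩ ball (0 : ℍ) 1 ⊆ {(0 : ℍ)} ∪ ⋃ i, A i := by
    intro x hx
    by_cases hx0 : x = 0
    · exact Or.inl hx0
    · obtain ⟨⟨hKN, hxS⟩, hxb⟩ := hx
      obtain ⟨i, hi⟩ := mem_iUnion.mp (hcover hxS)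
      exact Or.inr (mem_iUnion.mpr ⟨i, ⟨⟨⟨hx0, hxS⟩, hi⟩, hxb⟩, hKN⟩)
  -- `F` is injective on each piece
  have hFinj : ∀ i, InjOn F (A i) := by
    intro i x hx y hy hxy
    have hx0 : x ≠ 0 := hx.1.1.1.1
    have hy0 : y ≠ 0 := hy.1.1.1.1
    have hn : ‖x‖ = ‖y‖ := by rw [← hnormF x, ← hnormF y, hxy]
    have hq : su2Quat (K (quatToSU2 x)) = su2Quat (K (quatToSU2 y)) := by
      have h1 : ‖x‖ • su2Quat (K (quatToSU2 x)) = ‖y‖ • su2Quat (K (quatToSU2 y)) := hxy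
      rw [hn] at h1
      exact smul_right_injective ℍ (norm_ne_zero_iff.2 hy0) h1
    have hKeq : K (quatToSU2 x) = K (quatToSU2 y) := by
      rw [← quatToSU2_su2Quat (K (quatToSU2 x)), hq, quatToSU2_su2Quat]
    have hπ : quatToSU2 x = quatToSU2 y := hinj i hx.1.1.2 hy.1.1.2 hKeq
    have h2 := congrArg su2Quat hπ
    rw [su2Quat_quatToSU2 hx0, su2Quat_quatToSU2 hy0, ← hn] at h2
    exact smul_right_injective ℍ (inv_ne_zero (norm_ne_zero_iff.2 hx0)) h2
  -- images of the pieces lie in the cone over `N` inside the unit ball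
  have hFA : ∀ i, F '' A i ⊆ quatToSU2 ⁻¹' N ∩ ball (0 : ℍ) 1 := by
    rintro i _ ⟨x, hx, rfl⟩
    have hx0 : x ≠ 0 := hx.1.1.1.1
    refine ⟨?_, ?_⟩
    · show quatToSU2 (F x) ∈ N
      rw [hFx x hx0]
      exact hx.2
    · rw [mem_ball_zero_iff, hnormF]
      exact mem_ball_zero_iff.mp hx.1.2
  -- §3 on each piece
  have hpiece : ∀ i, ENNReal.ofReal (c ^ 4) * volume (A i) ≤ volume (quatToSU2 ⁻¹' N ∩ ball (0 : ℍ) 1) := by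
    intro i
    have h := measure_image_ge_of_coneExt volume hC hC0 (F := F) (k := k) (k' := fun x => k' (‖x‖⁻¹ • x))
      (fun x hx => ?_) (fun x hx => hk _ (hunit x hx.1) (by rw [hproj x hx.1]; exact hx.2)) (fun x hx => ?_) hc0 hc1
      (fun x hx v hv => ?_) (hAm i) (hAC i) (hFinj i)
    · rw [Quaternion.finrank_eq_four] at h
      exact h.trans (measure_mono (hFA i))
    · simp only [hF_def]
      rw [hkK _ (hunit x hx.1) (by rw [hproj x hx.1]; exact hx.2), hproj x hx.1]
    · rw [hkK _ (hunit x hx.1) (by rw [hproj x hx.1]; exact hx.2), norm_su2Quat]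
    · refine hbd _ (hunit x hx.1) (by rw [hproj x hx.1]; exact hx.2) v ?_
      rw [real_inner_smul_left, hv, mul_zero]
  have hc4 : ENNReal.ofReal (c ^ 4) ≠ 0 := (ENNReal.ofReal_pos.2 (by positivity)).ne'
  have hpiece' : ∀ i, volume (A i) ≤ (ENNReal.ofReal (c ^ 4))⁻¹ * volume (quatToSU2 ⁻¹' N ∩ ball (0 : ℍ) 1) := by
    intro i
    calc volume (A i) = (ENNReal.ofReal (c ^ 4))⁻¹ * (ENNReal.ofReal (c ^ 4) * volume (A i)) := by
          rw [← mul_assoc, ENNReal.inv_mul_cancel hc4 ENNReal.ofReal_ne_top, one_mul]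
      _ ≤ (ENNReal.ofReal (c ^ 4))⁻¹ * volume (quatToSU2 ⁻¹' N ∩ ball (0 : ℍ) 1) :=
          mul_le_mul_of_nonneg_left (hpiece i) zero_le
  -- summing the pieces
  have hvol : volume (quatToSU2 ⁻¹' (K ⁻¹' N ∩ S) ∩ ball (0 : ℍ) 1) ≤
      n * ((ENNReal.ofReal (c ^ 4))⁻¹ * volume (quatToSU2 ⁻¹' N ∩ ball (0 : ℍ) 1)) := by
    calc volume (quatToSU2 ⁻¹' (K ⁻¹' N ∩ S) ∩ ball (0 : ℍ) 1)
        ≤ volume ({(0 : ℍ)} ∪ ⋃ i, A i) := measure_mono hsub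
      _ ≤ volume ({(0 : ℍ)} : Set ℍ) + volume (⋃ i, A i) := measure_union_le _ _
      _ = volume (⋃ i, A i) := by rw [measure_singleton, zero_add]
      _ ≤ ∑ i, volume (A i) := measure_iUnion_fintype_le _ _
      _ ≤ ∑ _i : Fin n, (ENNReal.ofReal (c ^ 4))⁻¹ * volume (quatToSU2 ⁻¹' N ∩ ball (0 : ℍ) 1) :=
          Finset.sum_le_sum fun i _ => hpiece' i
      _ = n * ((ENNReal.ofReal (c ^ 4))⁻¹ * volume (quatToSU2 ⁻¹' N ∩ ball (0 : ℍ) 1)) := by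
          rw [Finset.sum_const, Finset.card_univ, Fintype.card_fin, nsmul_eq_mul]
  rw [hHaar _ ((hK hN).inter hS.measurableSet), hHaar N hN]
  calc (volume (ball (0 : ℍ) 1))⁻¹ * volume (quatToSU2 ⁻¹' (K ⁻¹' N ∩ S) ∩ ball (0 : ℍ) 1)
      ≤ (volume (ball (0 : ℍ) 1))⁻¹ * (n * ((ENNReal.ofReal (c ^ 4))⁻¹ * volume (quatToSU2 ⁻¹' N ∩ ball (0 : ℍ) 1))) :=
        mul_le_mul_of_nonneg_left hvol zero_le
    _ = (n : ℝ≥0∞) * (ENNReal.ofReal (c ^ 4))⁻¹ * ((volume (ball (0 : ℍ) 1))⁻¹ * volume (quatToSU2 ⁻¹' N ∩ ball (0 : ℍ) 1)) := by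
        ring

/-- The same for the cell's `HaarData.haar` on `SU(2)` (definitionally `haarProbability`). [folklore] -/
theorem haarData_restrict_map_le_smul {S : Set (Matrix.specialUnitaryGroup (Fin 2) ℂ)} (hS : IsOpen S) {K : (Matrix.specialUnitaryGroup (Fin 2) ℂ) → (Matrix.specialUnitaryGroup (Fin 2) ℂ)} (hK : Measurable K)
    {k : ℍ → ℍ} {k' : ℍ → ℍ →L[ℝ] ℍ}
    (hk : ∀ u : ℍ, ‖u‖ = 1 → quatToSU2 u ∈ S → HasStrictFDerivAt k (k' u) u)
    (hkK : ∀ u : ℍ, ‖u‖ = 1 → quatToSU2 u ∈ S → k u = su2Quat (K (quatToSU2 u)))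
    {c : ℝ} (hc0 : 0 < c) (hc1 : c ≤ 1)
    (hbd : ∀ u : ℍ, ‖u‖ = 1 → quatToSU2 u ∈ S → ∀ v : ℍ, ⟪u, v⟫ = 0 → c * ‖v‖ ≤ ‖k' u v‖)
    {n : ℕ} (piece : Fin n → Set (Matrix.specialUnitaryGroup (Fin 2) ℂ)) (hpm : ∀ i, MeasurableSet (piece i)) (hcover : S ⊆ ⋃ i, piece i)
    (hinj : ∀ i, InjOn K (piece i)) :
    ((Literature.MathematicalPhysics.QuantumFieldTheory.Balaban1983to89.HaarData.haar : Measure (Matrix.specialUnitaryGroup (Fin 2) ℂ)).restrict S).map K ≤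
      ((n : ℝ≥0∞) * (ENNReal.ofReal (c ^ 4))⁻¹) •
        (Literature.MathematicalPhysics.QuantumFieldTheory.Balaban1983to89.HaarData.haar : Measure (Matrix.specialUnitaryGroup (Fin 2) ℂ)) :=
  haar_restrict_map_le_smul hS hK hk hkK hc0 hc1 hbd piece hpm hcover hinj

end SUTwo

end Summit.QuantumFields.YangMills.Theorems.HeightChiSqLHaarDominated

end
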